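import Literature.Probability.RandomGraphs.ErdosRenyi
import Mathlib.Combinatorics.SimpleGraph.Finite
import Mathlib.Data.Sym.Sym2.Order
import Mathlib.Algebra.BigOperators.Ring.Finset
import Mathlib.Algebra.BigOperators.Group.Finset.Piecewise
import HarnessLib

/-!
# The mass function of `G(n, p)`: cylinder probabilities, `Pr[G(n,p) = G]`, and the `p = 1/2` bridge

Proved API for the binomial random graph `erdosRenyi n p` of `ErdosRenyi.lean` (follow-ups listed
there as "Not here": joint independence of the edge indicators and the bridge to the edge-vector
model `erdosRenyiHalf` of `PlantedClique.lean`). No named facts.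

* `bernoulliVec_toOuterMeasure_cylinder` — cylinder sets of the product Bernoulli measure
  `bernoulliVec m q`: prescribing the bits on a set `U` of coordinates has probability
  `∏_{k ∈ U} w(σ k)` (`w(true) = q`, `w(false) = 1 - q`), i.e. the coordinates are independent
  `Bernoulli(q)`; `bernoulliVec_toOuterMeasure_apply_eq` (one bit, either value).
* `graphOfBits n s` names the sampling map `s ↦ fromRel (i < j ∧ s (i, j))` of `erdosRenyi`
  (`erdosRenyi_eq_map_graphOfBits` is `rfl`), with `graphOfBits_adj`, `graphOfBits_adj_of_lt`,
  `graphOfBits_eq_iff` (a bit vector yields `G` iff its bits at the pairs `i < j` are the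
  adjacency bits of `G`) and `erdosRenyi_toOuterMeasure_apply` (graph events as bit events).
* `ltPairs n` (the pairs `i < j`), `card_ltPairs_filter_adj : #{(i,j) : i<j, G.Adj i j} = e(G)`,
  `card_ltPairs : #ltPairs n = n choose 2`.
* **`erdosRenyi_apply_eq_prod`** / **`erdosRenyi_apply`**: `Pr[G(n, p) = G] =
  ∏_{i<j} (q if {i,j} ∈ E(G) else 1 - q) = q^{e(G)} (1 - q)^{(n choose 2) - e(G)}`,
  `q = edgeProb p` — the defining formula of the binomial model (Rödl–Ruciński 1995 p. 919: "all
  `(n choose 2)` decisions are mutually independent"); the clamped extremes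
  `erdosRenyi_apply_top_of_one_le` (`p ≥ 1`: `K_n` a.s.) and `erdosRenyi_apply_bot_of_nonpos`
  (`p ≤ 0`: empty graph a.s.).
* The bijection `graphEquivEdgeVec n : SimpleGraph (Fin n) ≃ EdgeVec n` (`G ↦ 𝟙_{E(G)}`, inverse
  `graphOfEdgeVec`), `card_edgeVec : |EdgeVec n| = 2^(n choose 2)`, `edgeProb_half`, and
  **`erdosRenyiHalf_map_graphOfEdgeVec : (erdosRenyiHalf n).map graphOfEdgeVec = erdosRenyi n (1/2)`**.

Still not here: the monotone coupling in `p`, and independence phrased as `iIndepFun`.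

## References

* [RodlRucinski1995] V. Rödl, A. Ruciński, J. Amer. Math. Soc. 8 (1995), p. 919 (the binomial
  model `K(n, p)`).
-/

noncomputable section

namespace Literature.Probability.RandomGraphs

open PlantedClique Finset

/-! ### Cylinder probabilities of the product Bernoulli measure -/

/-- `bernWeight q (decide P) = if P then q else 1 - q`. [folklore] -/
theorem bernWeight_decide (q : ENNReal) (P : Prop) [Decidable P] :
    bernWeight q (decide P) = if P then q else 1 - q := by
  by_cases h : P <;> simp [bernWeight, h]

/-- **Cylinder sets of `Bernoulli(q)^{⊗ m}`**: prescribing the bits on a set `U` of coordinates has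
probability `∏_{k ∈ U} w(σ k)` (`w(true) = q`, `w(false) = 1 - q`) — the coordinates are
independent `Bernoulli(q)` bits. [folklore] -/
theorem bernoulliVec_toOuterMeasure_cylinder {m : ℕ} (q : ENNReal) (hq : q ≤ 1)
    (U : Finset (Fin m)) (σ : Fin m → Bool) :
    (bernoulliVec m q hq).toOuterMeasure {s | ∀ k ∈ U, s k = σ k} =
      ∏ k ∈ U, bernWeight q (σ k) := by
  classical
  -- the cylinder as a `piFinset`
  set t : Fin m → Finset Bool := fun k => if k ∈ U then {σ k} else univ with ht
  have hmem : ∀ s : Fin m → Bool, s ∈ ({s | ∀ k ∈ U, s k = σ k} : Set (Fin m → Bool)) ↔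
      s ∈ Fintype.piFinset t := by
    intro s
    simp only [Set.mem_setOf_eq, Fintype.mem_piFinset, ht]
    refine forall_congr' fun k => ?_
    by_cases hk : k ∈ U <;> simp [hk]
  have hset : ({s | ∀ k ∈ U, s k = σ k} : Set (Fin m → Bool)) = ↑(Fintype.piFinset t) := by
    ext s
    rw [hmem s, mem_coe]
  rw [hset, PMF.toOuterMeasure_apply_finset]
  simp only [bernoulliVec_apply]
  rw [← Finset.prod_univ_sum]
  have hk : ∀ k : Fin m, ∑ b ∈ t k, bernWeight q b = if k ∈ U then bernWeight q (σ k) else 1 := by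
    intro k
    by_cases hkU : k ∈ U
    · simp [ht, hkU]
    · simp only [ht, hkU, if_false]
      rw [Fintype.sum_bool, bernWeight_true_add_false hq]
  simp_rw [hk]
  rw [prod_ite_mem, univ_inter]

/-- One prescribed bit: `Pr[s k = b] = w(b)`. [folklore] -/
theorem bernoulliVec_toOuterMeasure_apply_eq {m : ℕ} (q : ENNReal) (hq : q ≤ 1) (k : Fin m)
    (b : Bool) : (bernoulliVec m q hq).toOuterMeasure {s | s k = b} = bernWeight q b := by
  have h := bernoulliVec_toOuterMeasure_cylinder q hq {k} (fun _ => b)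
  simp only [mem_singleton, forall_eq, prod_singleton] at h
  exact h

/-! ### The sampling map of `G(n, p)` -/

/-- The graph on `Fin n` read off a bit vector indexed by ORDERED pairs `(i, j) ↦ j + n i`
(`finProdFinEquiv`): `{i, j}` with `i < j` is an edge iff the bit at `(i, j)` is `true` (the bits at
`(i, j)` with `i ≥ j` are ignored). [folklore] -/
def graphOfBits (n : ℕ) (s : Fin (n * n) → Bool) : SimpleGraph (Fin n) :=
  SimpleGraph.fromRel fun i j : Fin n => i < j ∧ s (finProdFinEquiv (i, j)) = true

/-- Adjacency in `graphOfBits`. [folklore] -/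
theorem graphOfBits_adj {n : ℕ} (s : Fin (n * n) → Bool) (u v : Fin n) :
    (graphOfBits n s).Adj u v ↔ u ≠ v ∧
      (u < v ∧ s (finProdFinEquiv (u, v)) = true ∨ v < u ∧ s (finProdFinEquiv (v, u)) = true) := by
  simp [graphOfBits, SimpleGraph.fromRel_adj]

/-- For `u < v`: `{u, v}` is an edge of `graphOfBits n s` iff the bit at `(u, v)` is set.
[folklore] -/
theorem graphOfBits_adj_of_lt {n : ℕ} (s : Fin (n * n) → Bool) {u v : Fin n} (h : u < v) :
    (graphOfBits n s).Adj u v ↔ s (finProdFinEquiv (u, v)) = true := by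
  rw [graphOfBits_adj]
  constructor
  · rintro ⟨-, h₁ | h₂⟩
    · exact h₁.2
    · exact absurd (h.trans h₂.1) (lt_irrefl _)
  · intro hs
    exact ⟨h.ne, Or.inl ⟨h, hs⟩⟩

/-- `G(n, p)` as the push-forward of `Bernoulli(edgeProb p)^{⊗ n²}` along `graphOfBits`.
[folklore] -/
theorem erdosRenyi_eq_map_graphOfBits (n : ℕ) (p : ℝ) :
    erdosRenyi n p = (bernoulliVec (n * n) (edgeProb p) (edgeProb_le_one p)).map (graphOfBits n) :=
  rfl

/-- Probabilities of graph events under `G(n, p)` are probabilities of bit-vector events under the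
product Bernoulli measure. [folklore] -/
theorem erdosRenyi_toOuterMeasure_apply (n : ℕ) (p : ℝ) (S : Set (SimpleGraph (Fin n))) :
    (erdosRenyi n p).toOuterMeasure S =
      (bernoulliVec (n * n) (edgeProb p) (edgeProb_le_one p)).toOuterMeasure
        {s | graphOfBits n s ∈ S} := by
  rw [erdosRenyi_eq_map_graphOfBits, PMF.toOuterMeasure_map_apply]
  rfl

/-! ### The mass of a graph: `G(n, p)` is the binomial random graph -/

/-- The ordered pairs `(i, j)` of vertices with `i < j` — one per potential edge `{i, j}`.
[folklore] -/
def ltPairs (n : ℕ) : Finset (Fin n × Fin n) := univ.filter fun q => q.1 < q.2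

/-- Membership in `ltPairs`. [folklore] -/
@[simp] theorem mem_ltPairs {n : ℕ} (q : Fin n × Fin n) : q ∈ ltPairs n ↔ q.1 < q.2 := by
  simp [ltPairs]

/-- The pairs `i < j` joined in `G` are in bijection with the edges of `G` (`(i, j) ↦ {i, j}`,
inverse `e ↦ (min e, max e)`): `#{(i, j) : i < j, G.Adj i j} = e(G)`. [folklore] -/
theorem card_ltPairs_filter_adj {n : ℕ} (G : SimpleGraph (Fin n)) [DecidableRel G.Adj] :
    #((ltPairs n).filter fun q => G.Adj q.1 q.2) = #G.edgeFinset := by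
  refine card_nbij' (fun q => s(q.1, q.2)) (fun e => (e.inf, e.sup)) ?_ ?_ ?_ ?_
  · intro q hq
    simp only [mem_coe, mem_filter, mem_ltPairs] at hq
    simpa [SimpleGraph.mem_edgeFinset] using hq.2
  · intro e he
    induction e using Sym2.ind with
    | _ a b =>
      simp only [mem_coe, SimpleGraph.mem_edgeFinset, SimpleGraph.mem_edgeSet] at he
      simp only [mem_coe, mem_filter, mem_ltPairs, Sym2.inf_mk, Sym2.sup_mk]
      rcases lt_or_gt_of_ne he.ne with h | h
      · rw [min_eq_left h.le, max_eq_right h.le]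
        exact ⟨h, he⟩
      · rw [min_eq_right h.le, max_eq_left h.le]
        exact ⟨h, he.symm⟩
  · intro q hq
    simp only [mem_coe, mem_filter, mem_ltPairs] at hq
    simp [min_eq_left hq.1.le, max_eq_right hq.1.le]
  · intro e _
    induction e using Sym2.ind with
    | _ a b =>
      simp only [Sym2.inf_mk, Sym2.sup_mk]
      rcases le_total a b with h | h
      · rw [min_eq_left h, max_eq_right h]
      · rw [min_eq_right h, max_eq_left h, Sym2.eq_swap]

/-- There are `n choose 2` pairs `i < j` in `Fin n`. [folklore] -/
theorem card_ltPairs (n : ℕ) : #(ltPairs n) = n.choose 2 := by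
  have h := card_ltPairs_filter_adj (⊤ : SimpleGraph (Fin n))
  rw [SimpleGraph.card_edgeFinset_top_eq_card_choose_two, Fintype.card_fin] at h
  rw [← h]
  congr 1
  ext q
  simp only [mem_filter, mem_ltPairs, SimpleGraph.top_adj, ne_eq, iff_self_and]
  exact fun hq => hq.ne

/-- A bit vector yields the graph `G` iff its bits at the pairs `i < j` are the adjacency bits of
`G`. [folklore] -/
theorem graphOfBits_eq_iff {n : ℕ} (s : Fin (n * n) → Bool) (G : SimpleGraph (Fin n))
    [DecidableRel G.Adj] :
    graphOfBits n s = G ↔ ∀ q ∈ ltPairs n, s (finProdFinEquiv q) = decide (G.Adj q.1 q.2) := by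
  constructor
  · rintro rfl q hq
    rw [mem_ltPairs] at hq
    rcases hs : s (finProdFinEquiv q) with _ | _
    · symm
      rw [decide_eq_false_iff_not, graphOfBits_adj_of_lt s hq, hs]
      exact Bool.false_ne_true
    · symm
      rw [decide_eq_true_iff, graphOfBits_adj_of_lt s hq, hs]
  · intro h
    ext u v
    rcases lt_trichotomy u v with huv | rfl | hvu
    · rw [graphOfBits_adj_of_lt s huv, h (u, v) ((mem_ltPairs _).2 huv), decide_eq_true_iff]
    · simp only [SimpleGraph.irrefl]
    · rw [SimpleGraph.adj_comm, graphOfBits_adj_of_lt s hvu, h (v, u) ((mem_ltPairs _).2 hvu),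
        decide_eq_true_iff, SimpleGraph.adj_comm]

/-- **Mass function of `G(n, p)`, product form**: the probability of the single graph `G` is
`∏_{i<j} (q if {i,j} ∈ E(G) else 1 - q)`, `q = edgeProb p` — the `n choose 2` edge indicators are
independent `Bernoulli(q)` (Rödl–Ruciński p. 919: "all decisions are mutually independent").
[folklore] -/
theorem erdosRenyi_apply_eq_prod {n : ℕ} (p : ℝ) (G : SimpleGraph (Fin n)) [DecidableRel G.Adj] :
    erdosRenyi n p G =
      ∏ q ∈ ltPairs n, (if G.Adj q.1 q.2 then edgeProb p else 1 - edgeProb p) := by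
  classical
  rw [← PMF.toOuterMeasure_apply_singleton, erdosRenyi_toOuterMeasure_apply]
  -- the fibre of `G` is a cylinder set over the pairs `i < j`
  set U : Finset (Fin (n * n)) := (ltPairs n).map finProdFinEquiv.toEmbedding with hU
  set σ : Fin (n * n) → Bool := fun k =>
    decide (G.Adj (finProdFinEquiv.symm k).1 (finProdFinEquiv.symm k).2) with hσ
  have hfib : {s : Fin (n * n) → Bool | graphOfBits n s ∈ ({G} : Set (SimpleGraph (Fin n)))} =
      {s | ∀ k ∈ U, s k = σ k} := by
    ext s
    simp only [Set.mem_setOf_eq, Set.mem_singleton_iff, graphOfBits_eq_iff, hU, forall_mem_map,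
      Equiv.coe_toEmbedding, hσ, Equiv.symm_apply_apply]
  rw [hfib, bernoulliVec_toOuterMeasure_cylinder, hU, prod_map]
  refine prod_congr rfl fun q _ => ?_
  simp only [Equiv.coe_toEmbedding, hσ, Equiv.symm_apply_apply]
  exact bernWeight_decide _ _

/-- **Mass function of `G(n, p)`**: `Pr[G(n, p) = G] = q^{e(G)} (1 - q)^{(n choose 2) - e(G)}` with
`q = edgeProb p = min 1 (max 0 p)` — the defining formula of the binomial random graph.
[cite: RodlRucinski1995, §1 (p. 919, the binomial model `K(n, p)`)] -/
theorem erdosRenyi_apply {n : ℕ} (p : ℝ) (G : SimpleGraph (Fin n)) [DecidableRel G.Adj] :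
    erdosRenyi n p G =
      edgeProb p ^ #G.edgeFinset * (1 - edgeProb p) ^ (n.choose 2 - #G.edgeFinset) := by
  rw [erdosRenyi_apply_eq_prod, prod_ite, prod_const, prod_const, card_ltPairs_filter_adj]
  congr 2
  have h := card_filter_add_card_filter_not (s := ltPairs n) (fun q => G.Adj q.1 q.2)
  rw [card_ltPairs_filter_adj, card_ltPairs] at h
  omega

/-- `G(n, p)` for `p ≥ 1` is the complete graph almost surely. [folklore] -/
theorem erdosRenyi_apply_top_of_one_le {n : ℕ} {p : ℝ} (hp : 1 ≤ p) :
    erdosRenyi n p ⊤ = 1 := by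
  rw [erdosRenyi_apply, edgeProb_of_one_le hp, SimpleGraph.card_edgeFinset_top_eq_card_choose_two,
    Fintype.card_fin]
  simp

/-- `G(n, p)` for `p ≤ 0` is the empty graph almost surely. [folklore] -/
theorem erdosRenyi_apply_bot_of_nonpos {n : ℕ} {p : ℝ} (hp : p ≤ 0) :
    erdosRenyi n p ⊥ = 1 := by
  have h0 : ∀ inst : Fintype ((⊥ : SimpleGraph (Fin n)).edgeSet),
      (@SimpleGraph.edgeFinset (Fin n) ⊥ inst).card = 0 := fun inst =>
    Finset.card_eq_zero.mpr (SimpleGraph.edgeFinset_eq_empty.mpr rfl)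
  rw [erdosRenyi_apply, edgeProb_of_nonpos hp, h0, pow_zero, one_mul, tsub_zero, one_pow]

/-! ### `p = 1/2`: the bridge to the edge-vector model `erdosRenyiHalf` of `PlantedClique.lean` -/

open Classical in
/-- Graphs on `Fin n` and edge-indicator vectors `EdgeVec n = E(K_n) → Bool` correspond
bijectively (`G ↦ 𝟙_{E(G)}`, inverse `graphOfEdgeVec`). [folklore] -/
def graphEquivEdgeVec (n : ℕ) : SimpleGraph (Fin n) ≃ EdgeVec n where
  toFun G := fun e => decide ((e : Sym2 (Fin n)) ∈ G.edgeSet)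
  invFun := graphOfEdgeVec
  left_inv G := by
    ext u v
    rw [graphOfEdgeVec_adj]
    simp only [decide_eq_true_eq, SimpleGraph.mem_edgeSet]
    exact ⟨fun ⟨_, h⟩ => h, fun h => ⟨h.ne, h⟩⟩
  right_inv x := by
    funext e
    obtain ⟨e, he⟩ := e
    induction e using Sym2.ind with
    | _ u v =>
      have huv : u ≠ v := by simpa using he
      by_cases hx : x ⟨s(u, v), he⟩ = true
      · rw [hx, decide_eq_true_iff, SimpleGraph.mem_edgeSet, graphOfEdgeVec_adj]
        exact ⟨huv, hx⟩
      · rw [Bool.not_eq_true] at hx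
        rw [hx, decide_eq_false_iff_not, SimpleGraph.mem_edgeSet, graphOfEdgeVec_adj]
        rintro ⟨_, h⟩
        rw [hx] at h
        exact Bool.false_ne_true h

/-- `graphEquivEdgeVec` inverts `graphOfEdgeVec`. [folklore] -/
@[simp] theorem graphEquivEdgeVec_symm_apply {n : ℕ} (x : EdgeVec n) :
    (graphEquivEdgeVec n).symm x = graphOfEdgeVec x := rfl

/-- There are `2^(n choose 2)` edge vectors (graphs) on `Fin n`. [folklore] -/
theorem card_edgeVec (n : ℕ) : Fintype.card (EdgeVec n) = 2 ^ n.choose 2 := by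
  rw [Fintype.card_fun, Fintype.card_bool, ← SimpleGraph.edgeFinset_card,
    SimpleGraph.card_edgeFinset_top_eq_card_choose_two, Fintype.card_fin]

/-- `edgeProb (1/2) = 1/2`. [folklore] -/
theorem edgeProb_half : edgeProb (1 / 2) = 2⁻¹ := by
  rw [edgeProb_eq (by norm_num), one_div, ENNReal.ofReal_inv_of_pos two_pos,
    ENNReal.ofReal_ofNat]

/-- **`G(n, 1/2)` two ways**: reading the uniform edge vector of `PlantedClique.erdosRenyiHalf` as a
graph gives exactly `erdosRenyi n (1/2)` (both give every graph mass `2^{-(n choose 2)}`).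
[folklore] -/
theorem erdosRenyiHalf_map_graphOfEdgeVec (n : ℕ) :
    (erdosRenyiHalf n).map graphOfEdgeVec = erdosRenyi n (1 / 2) := by
  classical
  ext G
  have hG : G = graphOfEdgeVec (graphEquivEdgeVec n G) := by
    rw [← graphEquivEdgeVec_symm_apply, Equiv.symm_apply_apply]
  rw [PMF.map_apply, tsum_eq_single (graphEquivEdgeVec n G)]
  · rw [if_pos hG, erdosRenyiHalf, PMF.uniformOfFintype_apply,
      card_edgeVec, erdosRenyi_apply, edgeProb_half, ENNReal.one_sub_inv_two, ← pow_add,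
      Nat.add_sub_cancel' (by simpa using G.card_edgeFinset_le_card_choose_two), Nat.cast_pow,
      Nat.cast_ofNat, ENNReal.inv_pow]
  · intro x hx
    rw [if_neg]
    intro hGx
    apply hx
    rw [hGx, ← graphEquivEdgeVec_symm_apply, Equiv.apply_symm_apply]

end Literature.Probability.RandomGraphs

end
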